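import Mathlib.AlgebraicGeometry.EllipticCurve.Reduction
import Mathlib.NumberTheory.LocalField.Basic
import Mathlib.RingTheory.Valuation.ValuationRing
import Literature.NumberTheory.GaloisRepresentations.SerreWeight
import Literature.NumberTheory.EllipticCurves.GaloisAction
import Literature.NumberTheory.Automorphic.BCDTModularity
import HarnessLib

/-!
# Fontaine's ramification bound for the `pⁿ`-torsion of an elliptic curve with good reduction
# (Fontaine 1985, Théorème A = §2.1 Théorème 1)

Topic `NumberTheory/GaloisRepresentations`.  NAMED FACT (D-0014: a published theorem whose proof is
not formalised; users take it as a hypothesis `(h : fontaine1985_absUpperInertia_smul_torsion_eq F p n)`)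
plus one proved corollary.

## The printed statement (J.-M. Fontaine, *Il n'y a pas de variété abélienne sur `ℤ`*, Invent.
## Math. 81 (1985) 515–538 [Fontaine1985]; read first-hand from the Göttingen digitisation of the
## volume, GDZ PPN356556735_0081, LOG_0033, OCR text kept in the seat folder `lit/fontaine1985/`)

Conventions (p. 515): "un groupe fini sur `A` est un schéma en groupes commutatifs, fini et plat sur
`Spec A`".  Introduction (p. 515): "soit `K` un corps de caractéristique `0`, complet pour une
valuation discrète, à corps résiduel parfait `k` de caractéristique `p ≠ 0` et soit `e` l'indice de
ramification absolu de `K`; soient `K̄` une clôture algébrique de `K`, `G = Gal(K̄/K)`, et, pour `u`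
réel `≥ -1`, `G^u` les groupes de ramification en numérotation supérieure au sens de Serre ([Se1],
chap. IV); posons enfin `G^{(u)} = G^{u-1}`.

**Théorème A.** Soit `n` un entier `≥ 1` et soit `J` un groupe fini sur l'anneau des entiers `O_K`
de `K`, tué par `pⁿ`.  Si `u > e (n + 1/(p-1))`, `G^{(u)}` opère trivialement sur `J(K̄)`."

(Corollaire, p. 516: with `v₀` the valuation of `L = K(J(K̄))` normalised by `v₀(p) = 1`,
`v₀(𝔇_{L/K}) < n + 1/(p-1)`.  §2.1 Théorème 1 (p. 525) is the same statement with `e = v_K(p)`: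
"On a `G_K^{(u)} ⊂ H` pour tout `u > e (n + 1/(p-1))` [`H` the kernel of the action of `G_K` on
`J(K̄)`] et `v_K(𝔇_{L/K}) < e (n + 1/(p-1))`."  §1.2 Remarque (i) (p. 518) records the dictionary
with Serre's numbering: Serre's `G_i` is Fontaine's `G_{((i+1)/e_{L/K})}` and Serre's `G^u` is
Fontaine's `G^{(u+1)}`.)

Hence, in SERRE's upper numbering — which is the tree's (`absUpperInertia F v = Γ_F^v`,
`RamificationFiltration`, Serre *Corps locaux* IV §3: `G_i = {σ | v_L(σx - x) ≥ i+1}`,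
`φ(u) = ∫₀ᵘ dt/(G₀ : G_t)`, `G^v = G_{ψ v}`) — Théorème A reads:
**`Γ_K^v` acts trivially on `J(K̄)` for every `v > e (n + 1/(p-1)) - 1`.**
(Sanity checks of the convention: `J = μ_p` over `ℤ_p` — jump `0`, bound `1/(p-1)`; the `p`-torsion
of an ordinary elliptic curve over `ℤ_p` with Serre–Tate parameter `1 + p` — upper jump exactly
`1/(p-1)`, the boundary, allowed since the inequality is strict; a Tate curve `E_q/ℚ_p` with `p ∤ v(q)`
— jump `1 + 1/(p-1) = p/(p-1)`, excluded, as it must be since `E_q[p]` is not finite flat over `ℤ_p`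
(Serre 1987 §2.9 Prop. 5 (ii)); `μ_{p²}` over `ℤ_p` (`n = 2`) — jump `1 ≤ 1 + 1/(p-1)`.)

Fontaine applies the theorem to "le noyau de la multiplication par `pⁿ`" of an abelian variety with
good reduction (p. 517, Corollaire; §3.4.6 Cor. 2, p. 536: "Son modèle de Néron `𝒜` est un schéma
abélien sur `O` … le système des `(𝒜_{pⁿ})_{n ∈ ℕ}` est un groupe `p`-divisible sur `O`"; §2.2
Remarque (b), p. 526, the same for `H^i_ét(X_K̄, ℤ/pⁿ)` of a proper smooth `X/O_K`): for an elliptic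
curve `E/K` with good reduction, `J = 𝓔[pⁿ]` (the `pⁿ`-torsion of its smooth proper model `𝓔/O_K`,
an abelian scheme of relative dimension one) is a finite flat `O_K`-group killed by `pⁿ` with
`J(K̄) = E[pⁿ](K̄)`.  THIS is the case vendored here — the tree has no notion of finite flat group
scheme over `O_K` (conventions §4: a notion is only defined when some requester needs its generality),
whereas it has everything for the elliptic case: Mathlib's `WeierstrassCurve.HasGoodReduction 𝒪[F]`
(a minimal Weierstrass model with unit discriminant, *AEC* VII.5), the `Γ_F`-module `E(F̄)`
(`WeierstrassCurve.geomPoints`, file `EllipticCurves/GaloisAction`) and the upper-numbering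
filtration `absUpperInertia F v` of `Γ_F` for a non-archimedean local field `F` (finite residue
field — a special case of Fontaine's perfect `k`).

## Contents

* `fontaine1985_absUpperInertia_smul_torsion_eq F p n` (**named fact**, Théorème A for
  `J = 𝓔[pⁿ]`): `F` a non-archimedean local field of characteristic `0` and residue characteristic
  `p`, `e = v_F(p)` its absolute ramification index (`IsDiscreteValuationRing.addVal 𝒪[F] p = e`),
  `E/F` an elliptic curve with good reduction (some Weierstrass model `C • W` is minimal with unit
  discriminant), `n ≥ 1`: for every real `v > e (n + 1/(p-1)) - 1`, every `σ ∈ Γ_F^v` fixes every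
  `P ∈ E(F̄)` with `pⁿ P = O`.
* `WeierstrassCurve.IsTorsionGaloisRep.isPeuRamifie_of_hasGoodReduction_of_fontaine1985`
  (**proved** from the fact with `n = 1`, `e = 1`): over an ABSOLUTELY UNRAMIFIED `F` (`v_F(p) = 1`,
  e.g. `F = ℚ_p`), every framed model `ρ̄ : Γ_F → GL₂(𝔽_p)` of `E[p]` (`W.IsTorsionGaloisRep p ρ̄`)
  of an elliptic curve with good reduction is *peu ramifiée* in the tree's sense
  (`ModPGaloisRep.IsPeuRamifie`: `ρ̄(Γ_F^v) = 1` for all `v > 1`), because Fontaine's bound is then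
  `1/(p-1) ≤ 1`.  This is the Galois-theoretic content of "`ρ̄` finie en `p` ⇒ `k(ρ̄) = 2`"
  (Serre, Duke 54 (1987), §2.8 Prop. 4, §2.9 Prop. 5 (i); Edixhoven 1992 §2), conditional here on the
  named fact; for `E/ℚ` and `p` odd the tree proves it unconditionally by Serre's own argument
  (`WeierstrassCurve.isPeuRamifie_restrictField_of_hasGoodReductionAt`, `GoodReductionPeuRamifieProofs`).

## How a consumer over a RAMIFIED base uses the fact (not formalised here)

For `E/ℚ_p` acquiring good reduction over a finite extension `L/ℚ_p` (e.g. the tame quartic class at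
`p = 3`: good reduction over `L = ℚ_3(3^{1/4})`, `e_L = 4`), apply the fact over `L`
(`v > e_L (n + 1/(p-1)) - 1`, i.e. `v > 5` for `p = 3`, `n = 1`, `e_L = 4`) and transport along
`Γ_L ≤ Γ_{ℚ_p}`: when `L/ℚ_p` is TAMELY ramified of index `e_L`, `Γ_{ℚ_p}^v = Γ_L^{e_L v}` for
`v > 0` (Serre IV §1 Prop. 2, §3: the wild groups `G_t`, `t > 0`, lie in the subgroup and
`φ_G = φ_H / e_L` on `[0, ∞)`), so `Γ_{ℚ_3}^v` fixes `E[3]` for `v > 5/4`; a très ramifié class has its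
upper jump at `p/(p-1) = 3/2 > 5/4` (Kummer theory), whence peu ramifié.  Neither the subgroup
transport nor the Kummer jump is part of Fontaine's theorem; they are the consumer's.

## Not here

The différente bound (Théorème A, second assertion / Corollaire, p. 516); the general finite flat
`J` (no such notion in the tree) and general perfect residue fields; Fontaine's finer Prop. 1.7
(p. 516) for finite flat local complete intersection algebras.
`-- TODO(general form): J an arbitrary finite flat commutative O_K-group killed by pⁿ; v_K(𝔇_{L/K}) < e(n + 1/(p-1)).`

## References

* [Fontaine1985] J.-M. Fontaine, *Il n'y a pas de variété abélienne sur `ℤ`*, Invent. Math. 81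
  (1985), 515–538: Introduction and Théorème A (p. 515), Corollaire (p. 516), §1.1–1.2 (pp. 517–518,
  numbering conventions, Remarque 1.2 (i)), §2.1 Théorème 1 (p. 525), §2.2 Remarque (b) (p. 526),
  §3.4.6 Corollaire 2 (p. 536).
* [SerreLocalFields1979] J.-P. Serre, *Local Fields*, Ch. IV §1, §3 (upper numbering; Prop. 14 and
  Remark 1 for infinite extensions).
* [Serre1987] J.-P. Serre, Duke Math. J. 54 (1987), §2.4, §2.8 Prop. 4, §2.9 Prop. 5 (i).
* [SilvermanAEC2009] J. H. Silverman, *The Arithmetic of Elliptic Curves*, VII.5 (good reduction),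
  III.§7 (`E[m]` as a Galois module).

## Design

No instance, no `sorry`, no new notion.  The fact is a `def … : Prop` parametrised by the local field
`F` (section variables, as the other local named facts of this directory, e.g.
`ModPGaloisRep.IsLevelTwoWeight.isTamelyRamified`) and by `p n : ℕ`; the residue characteristic is
`ringChar 𝓀[F] = p` and the absolute ramification index is the canonical
`IsDiscreteValuationRing.addVal 𝒪[F] (p : 𝒪[F])` (no uniformiser chosen), as in
`PeuRamifieCriterionProofs`.  "Good reduction" is Mathlib's `WeierstrassCurve.HasGoodReduction 𝒪[F]`
of SOME model `C • W` (model-independent meaning; `𝒪[F] = (valuation F).integer` is a discrete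
valuation ring with fraction field `F` by `Mathlib.NumberTheory.LocalField.Basic` and
`Valuation.instIsFractionRingInteger`).  The torsion condition is written on `E(F̄) = geomPoints W` as
`(p : ℤ) ^ n • P = 0`, the primitive form of `P ∈ E[pⁿ]` (`WeierstrassCurve.geomTorsion`,
`Submodule.mem_torsionBy_iff`).  The bound is the real number `e (n + 1/(p-1)) - 1` with Serre's
numbering, see above; `p ≥ 2` so `p - 1 ≥ 1`.
-/

noncomputable section

open scoped Pointwise Valued
open Field ValuativeRel

namespace Literature.NumberTheory.GaloisRepresentations

universe u

open GaloisRepresentations.IsNonarchimedeanLocalField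

variable (F : Type u) [Field F] [ValuativeRel F] [TopologicalSpace F] [IsNonarchimedeanLocalField F]

/-- **Fontaine 1985, Théorème A (= §2.1 Théorème 1, first assertion), for the `pⁿ`-torsion of an
elliptic curve with good reduction.**  Printed (p. 515, with `G^{(u)} := G^{u-1}`, `G^u` Serre's
upper numbering, p. 515 and §1.2 Rem. (i) p. 518; `e = v_K(p)`, p. 525): "Soit `n` un entier `≥ 1`
et soit `J` un groupe fini [= schéma en groupes commutatif, fini et plat] sur l'anneau des entiers
`O_K` de `K`, tué par `pⁿ`.  Si `u > e (n + 1/(p-1))`, `G^{(u)}` opère trivialement sur `J(K̄)`";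
applied, as Fontaine does (p. 517 "en appliquant ce théorème au noyau de la multiplication par
`pⁿ`"; §2.2 Rem. (b) p. 526; §3.4.6 p. 536), to `J = 𝓔[pⁿ]`, the `pⁿ`-torsion of the abelian
scheme `𝓔/O_K` extending an elliptic curve `E/K` WITH GOOD REDUCTION, whose points are
`E[pⁿ](K̄)`.  In the tree's language, for a non-archimedean local field `F` of characteristic `0`
with residue characteristic `p` and absolute ramification index `e = v_F(p)`
(`IsDiscreteValuationRing.addVal 𝒪[F] (p : 𝒪[F]) = e`), an elliptic curve `W/F` some model
`C • W` of which is a minimal Weierstrass equation with unit discriminant (Mathlib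
`WeierstrassCurve.HasGoodReduction 𝒪[F]`, *AEC* VII.5), and `n ≥ 1`: for every real
`v > e (n + 1/(p-1)) - 1` (Serre's numbering = the tree's `absUpperInertia F v = Γ_F^v`), every
`σ ∈ Γ_F^v` fixes every `P ∈ E(F̄)` with `pⁿ • P = 0`.  Special case of the printed theorem (finite
residue field; `J` the `pⁿ`-torsion of an elliptic curve with good reduction).
`-- TODO(general form): arbitrary finite flat commutative O_K-groups J killed by pⁿ, perfect residue field, and the bound v_K(𝔇_{L/K}) < e(n + 1/(p-1)) on the different of L = K(J(K̄)).`
[cite: Fontaine1985, Thm. A (p. 515) = §2.1 Thm. 1 (p. 525); §1.2 Rem. (i) (p. 518); p. 517, §2.2 Rem. (b) (p. 526), §3.4.6 (p. 536)] -/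
def fontaine1985_absUpperInertia_smul_torsion_eq (p n : ℕ) : Prop :=
  ∀ [CharZero F] [Fact p.Prime], ringChar 𝓀[F] = p →
    ∀ (e : ℕ), IsDiscreteValuationRing.addVal 𝒪[F] (p : 𝒪[F]) = e →
    ∀ (W : WeierstrassCurve F) [W.IsElliptic],
      (∃ C : WeierstrassCurve.VariableChange F, (C • W).HasGoodReduction 𝒪[F]) →
      1 ≤ n →
      ∀ (v : ℝ), (e : ℝ) * (n + 1 / ((p : ℝ) - 1)) - 1 < v →
        ∀ σ ∈ absUpperInertia F v,
          ∀ P : WeierstrassCurve.geomPoints W, ((p : ℤ) ^ n) • P = 0 → σ • P = P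

variable {F}

/-- **Good reduction over an absolutely unramified base ⇒ `ρ̄_{E,p}` peu ramifiée** (the
Galois-theoretic content of Serre, Duke 54 (1987), §2.8 Prop. 4 / §2.9 Prop. 5 (i): "`ρ_p` est
évidemment finie en `p`" ⇒ `k = 2`; Edixhoven 1992 §2), CONDITIONAL on Fontaine's Théorème A in the
form `fontaine1985_absUpperInertia_smul_torsion_eq F p 1`: if `v_F(p) = 1` (e.g. `F = ℚ_p`) and
`E/F` has good reduction, then for every framed model `ρ̄ : Γ_F → GL₂(𝔽_p)` of `E[p]`
(`W.IsTorsionGaloisRep p ρ̄`) and every `v > 1`, `ρ̄(Γ_F^v) = 1` (`ModPGaloisRep.IsPeuRamifie`):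
Fontaine's bound is `1 · (1 + 1/(p-1)) - 1 = 1/(p-1) ≤ 1 < v`, so `Γ_F^v` fixes `E[p]` pointwise,
and the frame `E[p] ≃ 𝔽_p²` is onto.  (For `E/ℚ`, `p` odd, the unconditional tree theorem is
`WeierstrassCurve.isPeuRamifie_restrictField_of_hasGoodReductionAt`.)
[cite: Fontaine1985, Thm. A (p. 515)] [cite: Serre1987, §2.8 Prop. 4, §2.9 Prop. 5 (i)] -/
theorem _root_.WeierstrassCurve.IsTorsionGaloisRep.isPeuRamifie_of_hasGoodReduction_of_fontaine1985
    [CharZero F] {p : ℕ} [Fact p.Prime]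
    (h : fontaine1985_absUpperInertia_smul_torsion_eq F p 1)
    (hp : ringChar 𝓀[F] = p) (he : IsDiscreteValuationRing.addVal 𝒪[F] (p : 𝒪[F]) = 1)
    {W : WeierstrassCurve F} [W.IsElliptic]
    (hW : ∃ C : WeierstrassCurve.VariableChange F, (C • W).HasGoodReduction 𝒪[F])
    {ρ : ModPGaloisRep F (ZMod p) 2} (hρ : W.IsTorsionGaloisRep p ρ) :
    ρ.IsPeuRamifie := by
  intro v hv σ hσ
  have hp1 : (1 : ℝ) < p := by exact_mod_cast (Fact.out : p.Prime).one_lt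
  -- Fontaine's bound for `e = n = 1` is `1/(p-1) ≤ 1 < v`
  have hbound : ((1 : ℕ) : ℝ) * ((1 : ℕ) + 1 / ((p : ℝ) - 1)) - 1 < v := by
    have h1 : 1 / ((p : ℝ) - 1) ≤ 1 := by
      rw [div_le_one (by linarith)]
      have h2 : (2 : ℝ) ≤ p := by exact_mod_cast (Fact.out : p.Prime).two_le
      linarith
    push_cast
    linarith
  have hfix : ∀ P : WeierstrassCurve.geomTorsion W p, σ • P = P := by
    intro P
    apply Subtype.ext
    rw [Literature.NumberTheory.EllipticCurves.AddSubgroup.torsionBy.coe_smul]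
    refine h hp 1 (by simpa using he) W hW le_rfl v hbound σ hσ (P : WeierstrassCurve.geomPoints W) ?_
    rw [pow_one]
    exact (Submodule.mem_torsionBy_iff (p : ℤ) (P : WeierstrassCurve.geomPoints W)).mp P.2
  -- the frame `E[p] ≃ 𝔽_p²` is onto, so `ρ̄ σ` fixes every vector
  obtain ⟨e, he'⟩ := hρ
  have hvec : ∀ w : Fin 2 → ZMod p,
      Matrix.mulVec ((ρ σ : GL (Fin 2) (ZMod p)) : Matrix (Fin 2) (Fin 2) (ZMod p)) w = w := by
    intro w
    obtain ⟨P, rfl⟩ := e.surjective w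
    rw [← he' σ P, hfix P]
  refine Matrix.GeneralLinearGroup.ext fun i j ↦ ?_
  have hij := congrFun (hvec (Pi.single j 1)) i
  rw [Matrix.mulVec_single_one] at hij
  change ((ρ σ : GL (Fin 2) (ZMod p)) : Matrix (Fin 2) (Fin 2) (ZMod p)) i j = _ at hij
  rw [hij, Units.val_one, Matrix.one_apply, Pi.single_apply]

end Literature.NumberTheory.GaloisRepresentations
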